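import Summits.QuantumFields.BalabanUV.Beta.D1BFx.PeriodicArrays

/-!
# `BalabanUV.Beta.D1BFx.ArrayTraceLimits` — road «BF-x», binder row D1, slot (K), debt X₃(ii) (ROUTE T of `HOME/b2b-balaban-beta-d1-p2/K-ASSEMBLY-SPEC.md`
# v1 §1), brick **TA3a «ARRAY TRACE LIMITS»** = the pure-`ℤ^D` half of TA3 «TORUS TRACES → ℤ⁴ TRACES» (split TA3 = TA3a (this file) + TA3b (torus ↔ `ℤ^D`
# glue on `hessT`, `b2b-balaban-gan24-formalise-leaf-03`), journal 2026-08-20): (A1) «DIAGONAL IMAGE SUM → TRACE»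
# `|Σ_a Σ'_x Σ'_m K x (x + s·m) a a − tr K| ≤ |F|·C·Zl D (δ∕2)·e^{(δ∕2)|p−q|₁}·imageTail D (δ∕2·s)` for `K` bi-localised at `(p, q)`; (A2) «TRACE AGAINST AN
# ARRAY → TRACE» `|tr (comp L (arr s Y)) − tr (comp L Y)| ≤ |F|²·C·C′·Zl D (δ∕2)²·e^{(δ∕2)|q−p′|₁}·imageTail D (δ∕2·s)`; (A3) the limits along any periods `σ_k → ∞`

WHY (K-ASSEMBLY-SPEC §1 TA3).  By TA2 (`PeriodicArrays`: `comp_arr_right` ∕ `comp_arr_left` ∕ `comp_arr_arr`, `sum_periodise₂_arr_diag`) and the fibred product rule,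
the TORUS traces of the periodised one-loop words are `ℤ^D` sums `Σ_a Σ'_x Σ'_m K x (x + s·m) a a` with `K` bi-localised UNIFORMLY in `s` (tadpole: `K = comp A W`;
bubble: `K = comp L (arr s V′)`, `L = comp (comp A V) A`, whose own `m = 0` term is (A2)'s `tr (comp L (arr s V′))`).  Every image but `m = 0` (resp. `u = 0`) is
THE TRACE OF A KERNEL BI-LOCALISED AT TWO POINTS `≥ s|m|₁ − O(1)` APART, hence exponentially small (`ExpKernelCalculus.abs_tr_le`, resp. `biLoc_comp_biLoc` +
`abs_tr_le`); summing the images gives an4's `imageTail`, which tends to `0` (`VolumeImages.tendsto_imageTail_atTop`).  No torus, no matrix, no limit kernel here;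
TA3b plugs (A1)∕(A2) into the torus unfoldings and TA4's `hessT`.
CONTENT.  §1 `l1_diag_image_ge`, `abs_diag_term_le`, `abs_tsum_diag_le` (each diagonal image is a small «trace»), `summable_diag_double`, **`abs_sum_diagImages_sub_tr_le`** (A1).
§2 `biLoc_shiftK`, `biLoc_comp_shiftK`, `abs_tr_comp_shiftK_le` (the `u`-th image meets `L` far away), `shiftK_zero`, **`comp_arr_eq_tsum_shiftK`** (`comp L (arr s Y) =
Σ'_u comp L (shiftK (s·u) Y)` entrywise), **`tr_comp_arr_eq_tsum`**, **`abs_tr_comp_arr_sub_le`** (A2).  §3 `tendsto_sum_diagImages_sub_tr` (UNIFORM FAMILY form: kernels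
`K_k` with common `(p, q, C, δ)`), `tendsto_sum_diagImages`, `tendsto_tr_comp_arr`.  Constants explicit and `s`-free; generic `D`, `F`.

HONEST FRAMING (cell contract, verbatim): «discharging `BetaPertH` makes Bałaban's UV stability UNCONDITIONAL — a real constructive-QFT result; it is NOT the continuum
limit and NOT the Clay problem.»  HONEST DEPENDENCY (verbatim): «continuum YM on T⁴ ⇐ BetaPertH ∧ nine spine estimates (0/9 proved); BetaPertH ⇐ (D1) ∧ (D4) ∧ CAP+tail;
G-an2-4 gates asym, D1 and NE2/3/4.»  [folklore] kernel bookkeeping (dominated convergence with explicit majorants) about the cell's own typed objects; no `def`, no `Prop`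
minted, nothing cited, no wall binder instantiated; 0 sorry; discharges NOTHING of (K), D1 or `BetaPertH`; NOT continuum, NOT Clay.  ABSOLUTE RULE (cell, verbatim): «No
internally-minted statement may enter as a cited fact. Every hypothesis is either kernel-proved in this package or a verbatim quotation of a PUBLISHED theorem with page
reference. The manuscript(s) under audit are NOT citable for their own disputed steps — they are the thing under adjudication; programme-internal (2001/route/tribunal)
claims are never citable.»  Provenance: G-an2-4 swarm leaf seat `b2b-balaban-gan24-formalise-leaf-06` (gen 29), cross-lane claim «K-TA3a» for road «BF-x», 2026-08-20.
-/

noncomputable section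

namespace Summit.QuantumFields.BalabanUV.Beta.D1BFx.ArrayTraceLimits

open Filter Topology
open scoped BigOperators
open Literature.MathematicalPhysics.QuantumFieldTheory.Balaban1983to89
open Literature.MathematicalPhysics.QuantumFieldTheory.Balaban1983to89.Beta
open B12Sec2to5 (l1 l1_nonneg summable_exp_neg_l1)
open ExpKernelCalculus (Site MKer Decays BiLoc comp shiftK tr Zl Zl_pos Zl_nonneg summable_exp_shift summable_exp_shift' tsum_exp_shift
  tsum_exp_shift' l1_sub_triangle l1_sub_symm exp_mid abs_tr_le biLoc_comp_biLoc)
open Summit.QuantumFields.BalabanUV.Beta.D1BFx.PeriodicArrays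

variable {D : ℕ} {F : Type*}

/-! ## §1 (A1) The diagonal image sum of a bi-localised kernel is its trace up to an image tail -/

section DiagImages

variable {K : MKer D F} {p q : Site D} {C δ : ℝ} {s : ℕ}

/-- [folklore] THE `m`-TH DIAGONAL IMAGE IS FAR: `|x − p|₁ + |x + s·m − q|₁ ≥ s|m|₁ − |p − q|₁`. -/
theorem l1_diag_image_ge (s : ℕ) (x p q m : Site D) :
    (s : ℝ) * l1 m - l1 (p - q) ≤ l1 (x - p) + l1 (imageShift s x m - q) := by
  have h1 := l1_imageShift_sub_ge s (p - q) m 0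
  have e : imageShift s (p - q) m = (imageShift s x m - q) - (x - p) := by funext i; simp [imageShift]; ring
  simp only [sub_zero] at h1
  rw [e] at h1
  linarith [l1_sub_le (imageShift s x m - q) (x - p)]

/-- [folklore] Termwise: `|K x (x + s·m) a b| ≤ C·e^{(δ∕2)|p−q|₁}·e^{−(δ∕2)s|m|₁} · e^{−(δ∕2)|x − p|₁}` (half the rate pays the image, half localises `x`). -/
theorem abs_diag_term_le (hK : BiLoc K p q C δ) (hδ : 0 ≤ δ) (x m : Site D) (a b : F) :
    |K x (imageShift s x m) a b| ≤
      C * Real.exp (δ / 2 * l1 (p - q)) * Real.exp (-(δ / 2 * s) * l1 m) * Real.exp (-(δ / 2) * l1 (x - p)) := by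
  refine (hK _ _ a b).trans ?_
  have hC : 0 ≤ C := hK.nonneg a
  have hg := l1_diag_image_ge s x p q m
  have hexp : Real.exp (-δ * (l1 (x - p) + l1 (imageShift s x m - q))) ≤
      Real.exp (δ / 2 * l1 (p - q)) * Real.exp (-(δ / 2 * s) * l1 m) * Real.exp (-(δ / 2) * l1 (x - p)) := by
    rw [← Real.exp_add, ← Real.exp_add, Real.exp_le_exp]
    nlinarith [l1_nonneg (imageShift s x m - q), l1_nonneg (x - p)]
  calc C * Real.exp (-δ * (l1 (x - p) + l1 (imageShift s x m - q)))
      ≤ C * (Real.exp (δ / 2 * l1 (p - q)) * Real.exp (-(δ / 2 * s) * l1 m) * Real.exp (-(δ / 2) * l1 (x - p))) :=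
        mul_le_mul_of_nonneg_left hexp hC
    _ = _ := by ring

/-- [folklore] **EACH DIAGONAL IMAGE IS A SMALL TRACE**: `x ↦ K x (x + s·m) a b` is summable and
`|Σ'_x K x (x + s·m) a b| ≤ C·Zl D (δ∕2)·e^{(δ∕2)|p−q|₁}·e^{−(δ∕2)s|m|₁}` (`δ > 0`). -/
theorem abs_tsum_diag_le (hK : BiLoc K p q C δ) (hδ : 0 < δ) (m : Site D) (a b : F) :
    (Summable fun x : Site D => K x (imageShift s x m) a b) ∧
      |∑' x : Site D, K x (imageShift s x m) a b| ≤
        C * Zl D (δ / 2) * Real.exp (δ / 2 * l1 (p - q)) * Real.exp (-(δ / 2 * s) * l1 m) := by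
  have hmaj := (summable_exp_shift' (half_pos hδ) p).mul_left (C * Real.exp (δ / 2 * l1 (p - q)) * Real.exp (-(δ / 2 * s) * l1 m))
  have hb : ∀ x : Site D, ‖K x (imageShift s x m) a b‖ ≤
      C * Real.exp (δ / 2 * l1 (p - q)) * Real.exp (-(δ / 2 * s) * l1 m) * Real.exp (-(δ / 2) * l1 (x - p)) := fun x => by
    rw [Real.norm_eq_abs]; exact abs_diag_term_le hK hδ.le x m a b
  refine ⟨Summable.of_norm_bounded hmaj hb, ?_⟩
  have h := tsum_of_norm_bounded hmaj.hasSum hb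
  rw [Real.norm_eq_abs, tsum_mul_left, tsum_exp_shift'] at h
  exact h.trans (le_of_eq (by ring))

/-- [folklore] The double family `(x, m) ↦ K x (x + s·m) a b` is summable on `ℤ^D × ℤ^D` (`δ > 0`; summing the per-image bounds over `m`). -/
theorem summable_diag_double [NeZero s] (hK : BiLoc K p q C δ) (hδ : 0 < δ) (a b : F) :
    Summable fun xm : Site D × Site D => K xm.1 (imageShift s xm.1 xm.2) a b := by
  have hC : 0 ≤ C := hK.nonneg a
  have hs : 0 < δ / 2 * s := mul_pos (half_pos hδ) (by exact_mod_cast Nat.pos_of_ne_zero (NeZero.ne s))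
  have hprod : Summable fun xm : Site D × Site D =>
      (C * Real.exp (δ / 2 * l1 (p - q)) * Real.exp (-(δ / 2) * l1 (xm.1 - p))) * Real.exp (-(δ / 2 * s) * l1 xm.2) :=
    Summable.mul_of_nonneg ((summable_exp_shift' (half_pos hδ) p).mul_left _) (summable_exp_neg_l1 hs D)
      (fun _ => by positivity) (fun _ => (Real.exp_pos _).le)
  refine Summable.of_norm_bounded hprod fun xm => ?_
  rw [Real.norm_eq_abs]
  exact (abs_diag_term_le hK hδ.le xm.1 xm.2 a b).trans (le_of_eq (by ring))

/-- [folklore] **(A1) «DIAGONAL IMAGE SUM → TRACE» WITH A RATE**: for a kernel bi-localised at `(p, q)` (`δ > 0`, `s ≥ 1`),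
`|Σ_a Σ'_x Σ'_m K x (x + s·m) a a − tr K| ≤ |F|·C·Zl D (δ∕2)·e^{(δ∕2)|p−q|₁}·imageTail D (δ∕2·s)` — the `m = 0` image is the trace, every other image is the
trace of a kernel bi-localised `≥ s|m|₁ − |p−q|₁` apart. -/
theorem abs_sum_diagImages_sub_tr_le [Fintype F] [NeZero s] (hK : BiLoc K p q C δ) (hδ : 0 < δ) :
    |∑ a, ∑' x : Site D, ∑' m : Site D, K x (imageShift s x m) a a - tr K| ≤
      (Fintype.card F : ℝ) * C * Zl D (δ / 2) * Real.exp (δ / 2 * l1 (p - q)) * imageTail D (δ / 2 * s) := by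
  have hs : 0 < δ / 2 * s := mul_pos (half_pos hδ) (by exact_mod_cast Nat.pos_of_ne_zero (NeZero.ne s))
  -- per fibre `a`: swap the sums, split off the image `m = 0`, bound the other images by `abs_tsum_diag_le`
  have hfib : ∀ a : F, |∑' x : Site D, ∑' m : Site D, K x (imageShift s x m) a a - ∑' x : Site D, K x x a a| ≤
      C * Zl D (δ / 2) * Real.exp (δ / 2 * l1 (p - q)) * imageTail D (δ / 2 * s) := by
    intro a
    have hC : 0 ≤ C := hK.nonneg a
    have hdbl : Summable (Function.uncurry fun x m : Site D => K x (imageShift s x m) a a) := summable_diag_double hK hδ a a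
    have hm : Summable fun m : Site D => ∑' x : Site D, K x (imageShift s x m) a a := hdbl.prod_symm.prod
    rw [← hdbl.tsum_comm, hm.tsum_eq_add_tsum_ite 0]
    simp only [imageShift_zero, add_sub_cancel_left]
    have hst : Summable fun m : Site D =>
        C * Zl D (δ / 2) * Real.exp (δ / 2 * l1 (p - q)) * (if m = 0 then 0 else Real.exp (-(δ / 2 * s) * l1 m)) :=
      (summable_imageTail_term hs).mul_left _
    have key := tsum_of_norm_bounded (f := fun m : Site D => if m = 0 then (0 : ℝ) else ∑' x : Site D, K x (imageShift s x m) a a)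
      hst.hasSum (fun m => by
        rw [Real.norm_eq_abs]
        split_ifs with hm0
        · simp
        · exact (abs_tsum_diag_le hK hδ m a a).2)
    simpa only [Real.norm_eq_abs, tsum_mul_left, imageTail] using key
  -- the trace, fibre sum outside
  have htr : tr K = ∑ a, ∑' x : Site D, K x x a a := by
    unfold ExpKernelCalculus.tr
    exact Summable.tsum_finsetSum fun a _ => by simpa using (abs_tsum_diag_le (s := s) hK hδ 0 a a).1
  rw [htr, ← Finset.sum_sub_distrib]
  refine (Finset.abs_sum_le_sum_abs _ _).trans ?_
  calc ∑ a, |∑' x : Site D, ∑' m : Site D, K x (imageShift s x m) a a - ∑' x : Site D, K x x a a|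
      ≤ ∑ _a : F, C * Zl D (δ / 2) * Real.exp (δ / 2 * l1 (p - q)) * imageTail D (δ / 2 * s) := Finset.sum_le_sum fun a _ => hfib a
    _ = _ := by rw [Finset.sum_const, Finset.card_univ, nsmul_eq_mul]; ring

end DiagImages

/-! ## §2 (A2) The trace against the array of a bi-localised kernel is the trace against the kernel up to an image tail -/

section ArrayTrace

variable [Fintype F] {L Y : MKer D F} {p q p' q' : Site D} {C C' δ : ℝ} {s : ℕ}

omit [Fintype F] in
/-- [folklore] A shifted bi-localised kernel is bi-localised at the shifted points: `BiLoc (shiftK v Y) (p′ − v) (q′ − v)`. -/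
theorem biLoc_shiftK (hY : BiLoc Y p' q' C' δ) (v : Site D) : BiLoc (shiftK v Y) (p' - v) (q' - v) C' δ := by
  intro x y a b
  have e1 : x + v - p' = x - (p' - v) := by abel
  have e2 : y + v - q' = y - (q' - v) := by abel
  simpa only [shiftK, e1, e2] using hY (x + v) (y + v) a b

/-- [folklore] THE `u`-TH IMAGE OF THE ARRAY MEETS `L` FAR AWAY: `BiLoc (comp L (shiftK (s·u) Y)) p (q′ − s·u)` with constant
`|F|·C·C′·Zl D (δ∕2)·e^{−(δ∕2)|q − p′ + s·u|₁}` (`ExpKernelCalculus.biLoc_comp_biLoc`: the inner points `q` and `p′ − s·u`). -/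
theorem biLoc_comp_shiftK (hL : BiLoc L p q C δ) (hY : BiLoc Y p' q' C' δ) (hδ : 0 < δ) (u : Site D) :
    BiLoc (comp L (shiftK ((s : ℤ) • u) Y)) p (q' - (s : ℤ) • u)
      ((Fintype.card F : ℝ) * (C * C') * Zl D (δ / 2) * Real.exp (-(δ / 2) * l1 (imageShift s (q - p') u))) δ := by
  have h := biLoc_comp_biLoc hL (biLoc_shiftK hY ((s : ℤ) • u)) hδ
  have e : q - (p' - (s : ℤ) • u) = imageShift s (q - p') u := by
    rw [imageShift_eq_add_smul]; abel
  rwa [e] at h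

/-- [folklore] … hence its trace is exponentially small in `s|u|₁`:
`|tr (comp L (shiftK (s·u) Y))| ≤ |F|²·C·C′·Zl D (δ∕2)²·e^{(δ∕2)|q−p′|₁}·e^{−(δ∕2)s|u|₁}` (`abs_tr_le`, `l1_imageShift_sub_ge`). -/
theorem abs_tr_comp_shiftK_le (hL : BiLoc L p q C δ) (hY : BiLoc Y p' q' C' δ) (hδ : 0 < δ) (u : Site D) :
    |tr (comp L (shiftK ((s : ℤ) • u) Y))| ≤
      (Fintype.card F : ℝ) ^ 2 * (C * C') * Zl D (δ / 2) ^ 2 * Real.exp (δ / 2 * l1 (q - p')) * Real.exp (-(δ / 2 * s) * l1 u) := by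
  rcases isEmpty_or_nonempty F with hF | hF
  · simp [ExpKernelCalculus.tr, Fintype.card_eq_zero]
  have hC : 0 ≤ C := hL.nonneg (Classical.arbitrary F)
  have hC' : 0 ≤ C' := hY.nonneg (Classical.arbitrary F)
  have h := abs_tr_le (biLoc_comp_shiftK (s := s) hL hY hδ u) hδ
  refine h.trans ?_
  have hfar : (s : ℝ) * l1 u - l1 (q - p') ≤ l1 (imageShift s (q - p') u) := by
    simpa only [sub_zero] using l1_imageShift_sub_ge s (q - p') u 0
  have hexp : Real.exp (-(δ / 2) * l1 (imageShift s (q - p') u)) ≤ Real.exp (δ / 2 * l1 (q - p')) * Real.exp (-(δ / 2 * s) * l1 u) := by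
    rw [← Real.exp_add, Real.exp_le_exp]; nlinarith [hδ.le]
  have hdrop : Real.exp (-(δ / 2) * l1 (p - (q' - (s : ℤ) • u))) ≤ 1 :=
    Real.exp_le_one_iff.mpr (by nlinarith [l1_nonneg (p - (q' - (s : ℤ) • u)), hδ.le])
  have hZ : 0 ≤ Zl D (δ / 2) := Zl_nonneg (half_pos hδ)
  calc (Fintype.card F : ℝ) * ((Fintype.card F : ℝ) * (C * C') * Zl D (δ / 2) * Real.exp (-(δ / 2) * l1 (imageShift s (q - p') u)))
        * Zl D (δ / 2) * Real.exp (-(δ / 2) * l1 (p - (q' - (s : ℤ) • u)))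
      ≤ (Fintype.card F : ℝ) * ((Fintype.card F : ℝ) * (C * C') * Zl D (δ / 2) * (Real.exp (δ / 2 * l1 (q - p')) * Real.exp (-(δ / 2 * s) * l1 u)))
        * Zl D (δ / 2) * 1 := by gcongr
    _ = _ := by ring

omit [Fintype F] in
/-- [folklore] `shiftK 0 = id`. -/
theorem shiftK_zero (Y : MKer D F) : shiftK 0 Y = Y := by
  funext x y a b; simp [shiftK]

/-- [folklore] **A LOCALISED KERNEL AGAINST AN ARRAY, IMAGE BY IMAGE**: `comp L (arr s Y) x z a b = Σ'_u comp L (shiftK (s·u) Y) x z a b`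
(`δ > 0`, `s ≥ 1`; Fubini over `(y, u)` against the product majorant `e^{−δ|y−q|₁}·e^{−δ|z+su−q′|₁}`). -/
theorem comp_arr_eq_tsum_shiftK [NeZero s] (hL : BiLoc L p q C δ) (hY : BiLoc Y p' q' C' δ) (hδ : 0 < δ) (x z : Site D) (a b : F) :
    comp L (arr s Y) x z a b = ∑' u : Site D, comp L (shiftK ((s : ℤ) • u) Y) x z a b := by
  have hC : 0 ≤ C := hL.nonneg a
  have hC' : 0 ≤ C' := hY.nonneg a
  have hmaj : ∀ y u : Site D, ‖∑ f, L x y a f * Y (imageShift s y u) (imageShift s z u) f b‖ ≤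
      ((Fintype.card F : ℝ) * C * C') * Real.exp (-δ * l1 (y - q)) * Real.exp (-δ * l1 (imageShift s z u - q')) := by
    intro y u
    rw [Real.norm_eq_abs]
    calc |∑ f, L x y a f * Y (imageShift s y u) (imageShift s z u) f b|
        ≤ ∑ f, |L x y a f * Y (imageShift s y u) (imageShift s z u) f b| := Finset.abs_sum_le_sum_abs _ _
      _ ≤ ∑ _f : F, C * Real.exp (-δ * l1 (y - q)) * (C' * Real.exp (-δ * l1 (imageShift s z u - q'))) := by
          refine Finset.sum_le_sum fun f _ => ?_
          rw [abs_mul]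
          refine mul_le_mul ?_ ?_ (abs_nonneg _) (by positivity)
          · exact (hL x y a f).trans (mul_le_mul_of_nonneg_left (Real.exp_le_exp.mpr (by nlinarith [l1_nonneg (x - p), hδ.le])) hC)
          · exact (hY _ _ f b).trans
              (mul_le_mul_of_nonneg_left (Real.exp_le_exp.mpr (by nlinarith [l1_nonneg (imageShift s y u - p'), hδ.le])) hC')
      _ = _ := by rw [Finset.sum_const, Finset.card_univ, nsmul_eq_mul]; ring
  have hsum : Summable (Function.uncurry fun y u : Site D => ∑ f, L x y a f * Y (imageShift s y u) (imageShift s z u) f b) :=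
    Summable.of_norm_bounded (Summable.mul_of_nonneg (((summable_exp_shift' hδ q).mul_left ((Fintype.card F : ℝ) * C * C')))
      (tsum_exp_imageShift_le hδ s z q').1 (fun _ => by positivity) (fun _ => (Real.exp_pos _).le)) (fun yu => hmaj yu.1 yu.2)
  calc comp L (arr s Y) x z a b
      = ∑' y : Site D, ∑' u : Site D, ∑ f, L x y a f * Y (imageShift s y u) (imageShift s z u) f b := by
        simp only [comp, arr_apply]
        refine tsum_congr fun y => ?_
        rw [Summable.tsum_finsetSum (fun f _ => (summable_arr_term hY hδ s y z f b).mul_left (L x y a f))]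
        exact Finset.sum_congr rfl fun f _ => tsum_mul_left.symm
    _ = ∑' u : Site D, ∑' y : Site D, ∑ f, L x y a f * Y (imageShift s y u) (imageShift s z u) f b := hsum.tsum_comm.symm
    _ = ∑' u : Site D, comp L (shiftK ((s : ℤ) • u) Y) x z a b := by simp only [comp, shiftK, imageShift_eq_add_smul]

/-- [folklore] **THE TRACE AGAINST THE ARRAY IS THE SUM OF THE IMAGE TRACES**: `tr (comp L (arr s Y)) = Σ'_u tr (comp L (shiftK (s·u) Y))`
(Fubini over `(x, u)`: the `u`-th image trace term is `≤ |F|·(BiLoc constant of the `u`-th image)·e^{−(δ∕2)|x−p|₁}`, summable in both). -/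
theorem tr_comp_arr_eq_tsum [NeZero s] (hL : BiLoc L p q C δ) (hY : BiLoc Y p' q' C' δ) (hδ : 0 < δ) :
    tr (comp L (arr s Y)) = ∑' u : Site D, tr (comp L (shiftK ((s : ℤ) • u) Y)) := by
  rcases isEmpty_or_nonempty F with hF | hF
  · simp [ExpKernelCalculus.tr]
  have hC : 0 ≤ C := hL.nonneg (Classical.arbitrary F)
  have hC' : 0 ≤ C' := hY.nonneg (Classical.arbitrary F)
  have hZ : 0 ≤ Zl D (δ / 2) := Zl_nonneg (half_pos hδ)
  -- the `u`-summable weight of the `u`-th image and the termwise bounds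
  set w : Site D → ℝ := fun u => Real.exp (-(δ / 2) * l1 (imageShift s (q - p') u)) with hw
  have hws : Summable w := by
    have h := (tsum_exp_imageShift_le (half_pos hδ) s (q - p') 0).1
    simpa only [sub_zero] using h
  have hKu := fun u : Site D => biLoc_comp_shiftK (s := s) hL hY hδ u
  -- per fibre `a`: `u ↦ K_u x x a a` is summable
  have hfib : ∀ (x : Site D) (a : F), Summable fun u : Site D => comp L (shiftK ((s : ℤ) • u) Y) x x a a := by
    intro x a
    refine Summable.of_norm_bounded (hws.mul_left ((Fintype.card F : ℝ) * (C * C') * Zl D (δ / 2))) fun u => ?_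
    rw [Real.norm_eq_abs]
    refine ((hKu u) x x a a).trans ?_
    have h1 : Real.exp (-δ * (l1 (x - p) + l1 (x - (q' - (s : ℤ) • u)))) ≤ 1 :=
      Real.exp_le_one_iff.mpr (by nlinarith [l1_nonneg (x - p), l1_nonneg (x - (q' - (s : ℤ) • u)), hδ.le])
    calc (Fintype.card F : ℝ) * (C * C') * Zl D (δ / 2) * w u * Real.exp (-δ * (l1 (x - p) + l1 (x - (q' - (s : ℤ) • u))))
        ≤ (Fintype.card F : ℝ) * (C * C') * Zl D (δ / 2) * w u * 1 := by gcongr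
      _ = _ := by ring
  -- the `(x, u)` family of fibre-summed diagonal terms is summable
  have hH : Summable (Function.uncurry fun x u : Site D => ∑ a, comp L (shiftK ((s : ℤ) • u) Y) x x a a) := by
    refine Summable.of_norm_bounded (Summable.mul_of_nonneg ((summable_exp_shift' (half_pos hδ) p).mul_left
      ((Fintype.card F : ℝ) * ((Fintype.card F : ℝ) * (C * C') * Zl D (δ / 2)))) hws (fun _ => by positivity) (fun _ => (Real.exp_pos _).le))
      fun xu => ?_
    rw [Real.norm_eq_abs]
    refine (ExpKernelCalculus.abs_trTerm_le (hKu xu.2) hδ.le xu.1).trans ?_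
    have h1 : Real.exp (-(δ / 2) * l1 (p - (q' - (s : ℤ) • xu.2))) ≤ 1 :=
      Real.exp_le_one_iff.mpr (by nlinarith [l1_nonneg (p - (q' - (s : ℤ) • xu.2)), hδ.le])
    calc (Fintype.card F : ℝ) * ((Fintype.card F : ℝ) * (C * C') * Zl D (δ / 2) * w xu.2)
          * Real.exp (-(δ / 2) * l1 (p - (q' - (s : ℤ) • xu.2))) * Real.exp (-(δ / 2) * l1 (xu.1 - p))
        ≤ (Fintype.card F : ℝ) * ((Fintype.card F : ℝ) * (C * C') * Zl D (δ / 2) * w xu.2) * 1 * Real.exp (-(δ / 2) * l1 (xu.1 - p)) := by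
          gcongr
      _ = _ := by ring
  calc tr (comp L (arr s Y)) = ∑' x : Site D, ∑ a, ∑' u : Site D, comp L (shiftK ((s : ℤ) • u) Y) x x a a := by
        simp only [ExpKernelCalculus.tr, comp_arr_eq_tsum_shiftK hL hY hδ]
    _ = ∑' x : Site D, ∑' u : Site D, ∑ a, comp L (shiftK ((s : ℤ) • u) Y) x x a a :=
        tsum_congr fun x => (Summable.tsum_finsetSum fun a _ => hfib x a).symm
    _ = ∑' u : Site D, ∑' x : Site D, ∑ a, comp L (shiftK ((s : ℤ) • u) Y) x x a a := hH.tsum_comm.symm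
    _ = ∑' u : Site D, tr (comp L (shiftK ((s : ℤ) • u) Y)) := rfl

/-- [folklore] **(A2) «TRACE AGAINST AN ARRAY → TRACE» WITH A RATE**: for `L` bi-localised at `(p, q)` and `Y` at `(p′, q′)` (common rate `δ > 0`, `s ≥ 1`),
`|tr (comp L (arr s Y)) − tr (comp L Y)| ≤ |F|²·C·C′·Zl D (δ∕2)²·e^{(δ∕2)|q−p′|₁}·imageTail D (δ∕2·s)`. -/
theorem abs_tr_comp_arr_sub_le [NeZero s] (hL : BiLoc L p q C δ) (hY : BiLoc Y p' q' C' δ) (hδ : 0 < δ) :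
    |tr (comp L (arr s Y)) - tr (comp L Y)| ≤
      (Fintype.card F : ℝ) ^ 2 * (C * C') * Zl D (δ / 2) ^ 2 * Real.exp (δ / 2 * l1 (q - p')) * imageTail D (δ / 2 * s) := by
  have hs : 0 < δ / 2 * s := mul_pos (half_pos hδ) (by exact_mod_cast Nat.pos_of_ne_zero (NeZero.ne s))
  have hst : Summable fun u : Site D => (Fintype.card F : ℝ) ^ 2 * (C * C') * Zl D (δ / 2) ^ 2 * Real.exp (δ / 2 * l1 (q - p')) *
      (if u = 0 then 0 else Real.exp (-(δ / 2 * s) * l1 u)) := (summable_imageTail_term hs).mul_left _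
  have hTu : Summable fun u : Site D => tr (comp L (shiftK ((s : ℤ) • u) Y)) :=
    Summable.of_norm_bounded ((summable_exp_neg_l1 hs D).mul_left _) fun u => by
      rw [Real.norm_eq_abs]; exact abs_tr_comp_shiftK_le hL hY hδ u
  rw [tr_comp_arr_eq_tsum hL hY hδ, hTu.tsum_eq_add_tsum_ite 0]
  simp only [smul_zero, shiftK_zero, add_sub_cancel_left]
  have key := tsum_of_norm_bounded (f := fun u : Site D => if u = 0 then (0 : ℝ) else tr (comp L (shiftK ((s : ℤ) • u) Y)))
    hst.hasSum (fun u => by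
      rw [Real.norm_eq_abs]
      split_ifs with hu0
      · simp
      · exact abs_tr_comp_shiftK_le hL hY hδ u)
  simpa only [Real.norm_eq_abs, tsum_mul_left, imageTail] using key

end ArrayTrace

/-! ## §3 (A3) The limits along any sequence of periods `σ_k → ∞` -/

section Limits

variable [Fintype F] {p q p' q' : Site D} {C C' δ : ℝ} {σ : ℕ → ℕ}

/-- [folklore] `const · imageTail D (δ∕2·σ_k) → 0` for `σ_k → ∞`, `δ > 0`. -/
theorem tendsto_const_mul_imageTail (hδ : 0 < δ) (hσ : Tendsto σ atTop atTop) (M : ℝ) :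
    Tendsto (fun k => M * imageTail D (δ / 2 * σ k)) atTop (𝓝 0) := by
  have h1 : Tendsto (fun k => δ / 2 * (σ k : ℝ)) atTop atTop :=
    Tendsto.const_mul_atTop (half_pos hδ) (tendsto_natCast_atTop_atTop.comp hσ)
  simpa using ((tendsto_imageTail_atTop D).comp h1).const_mul M

/-- [folklore] **(A1) ALONG A SEQUENCE, UNIFORM FAMILY FORM**: kernels `K_k` bi-localised at `(p, q)` with COMMON constants `(C, δ)` and periods `σ_k → ∞`:
`Σ_a Σ'_x Σ'_m K_k x (x + σ_k·m) a a − tr K_k → 0` (the bubble's `s`-dependent kernel `comp L (arr s V′)` is such a family by TA2 `decays_arr`). -/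
theorem tendsto_sum_diagImages_sub_tr {K : ℕ → MKer D F} (hK : ∀ k, BiLoc (K k) p q C δ) (hδ : 0 < δ) (hσ : Tendsto σ atTop atTop) :
    Tendsto (fun k => ∑ a, ∑' x : Site D, ∑' m : Site D, K k x (imageShift (σ k) x m) a a - tr (K k)) atTop (𝓝 0) := by
  refine squeeze_zero_norm' ?_ (tendsto_const_mul_imageTail (D := D) hδ hσ
    ((Fintype.card F : ℝ) * C * Zl D (δ / 2) * Real.exp (δ / 2 * l1 (p - q))))
  filter_upwards [hσ.eventually_ge_atTop 1] with k hk
  haveI : NeZero (σ k) := ⟨by omega⟩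
  simpa only [Real.norm_eq_abs] using abs_sum_diagImages_sub_tr_le (hK k) hδ

/-- [folklore] **(A1) ALONG A SEQUENCE**: for ONE kernel bi-localised at `(p, q)`, `Σ_a Σ'_x Σ'_m K x (x + σ_k·m) a a → tr K`. -/
theorem tendsto_sum_diagImages {K : MKer D F} (hK : BiLoc K p q C δ) (hδ : 0 < δ) (hσ : Tendsto σ atTop atTop) :
    Tendsto (fun k => ∑ a, ∑' x : Site D, ∑' m : Site D, K x (imageShift (σ k) x m) a a) atTop (𝓝 (tr K)) := by
  have h := tendsto_sum_diagImages_sub_tr (K := fun _ => K) (fun _ => hK) hδ hσ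
  simpa using h.add_const (tr K)

/-- [folklore] **(A2) ALONG A SEQUENCE**: `tr (comp L (arr σ_k Y)) → tr (comp L Y)` for `L`, `Y` bi-localised (common rate `δ > 0`), `σ_k → ∞`. -/
theorem tendsto_tr_comp_arr {L Y : MKer D F} (hL : BiLoc L p q C δ) (hY : BiLoc Y p' q' C' δ) (hδ : 0 < δ)
    (hσ : Tendsto σ atTop atTop) : Tendsto (fun k => tr (comp L (arr (σ k) Y))) atTop (𝓝 (tr (comp L Y))) := by
  have h0 : Tendsto (fun k => tr (comp L (arr (σ k) Y)) - tr (comp L Y)) atTop (𝓝 0) := by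
    refine squeeze_zero_norm' ?_ (tendsto_const_mul_imageTail (D := D) hδ hσ
      ((Fintype.card F : ℝ) ^ 2 * (C * C') * Zl D (δ / 2) ^ 2 * Real.exp (δ / 2 * l1 (q - p'))))
    filter_upwards [hσ.eventually_ge_atTop 1] with k hk
    haveI : NeZero (σ k) := ⟨by omega⟩
    simpa only [Real.norm_eq_abs] using abs_tr_comp_arr_sub_le hL hY hδ
  simpa using h0.add_const (tr (comp L Y))

end Limits

end Summit.QuantumFields.BalabanUV.Beta.D1BFx.ArrayTraceLimits

end
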